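import Literature.Topology.FourManifolds.AlexanderModuleTrivializer
import Mathlib.GroupTheory.HNNExtension
import Mathlib.GroupTheory.SemidirectProduct
import HarnessLib

/-!
# The Alexander module of an HNN extension (algebraic core of the Seifert-matrix presentation)

Topic `Literature/Topology/FourManifolds`; sibling of `AlexanderModule.lean` /
`AlexanderModuleTrivializer.lean`, written for the fact seat of
`Literature.Topology.FourManifolds.exists_eq_mul_invert_of_isSmoothlySlice` (Fox–Milnor). Several
named facts of the tree wait on the classical statement that **a Seifert matrix `V` of a knot
presents the Alexander module `G'/G''` of the knot group by the square matrix `V − tVᵀ`**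
(Rolfsen (1976), §8.C; Burde–Zieschang, *Knots*, Ch. 9): `Knot.exists_isAlexanderPolynomial`,
`Knot.IsAlexanderPolynomial.isUnit_eval_one` (`KnotGroup.lean`, see
`Knot.exists_isAlexanderPolynomial_of_square_presentation` in `KnotGroupAbelianization.lean`) and the
two Fox–Milnor facts (`SliceKnotsFoxMilnorMetabolizer.lean`,
`Knot.exists_eq_mul_invert_of_seifert_presentation`). When the knot complement is split along a
Seifert surface `F`, the Seifert–van Kampen theorem exhibits the knot group as an HNN extension
`Γ = ⟨G, t | t a t⁻¹ = φ a (a ∈ A)⟩` of `G = π₁(S³ ∖ F)` along `A = π₁(F)` (the two push-offs), the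
meridian being the stable letter `t`. This file proves, **purely algebraically and for an arbitrary
HNN extension**, the resulting presentation of the Alexander module: everything topological
(Seifert surfaces, van Kampen, Alexander duality `H₁(S³ ∖ F) ≅ Hom(H₁ F, ℤ)`) is left to the
geometric side, which only has to supply the group isomorphism and the integer matrices.

## Main statements (all proved; no definitions, no named facts, no `sorry`)

For `Γ = HNNExtension G A B φ` (Mathlib), `R = ℤ[Γᵃᵇ]`, and the Alexander module `Γ'/Γ''` of
`AlexanderModule.lean`:

* `AlexanderHNN.ker_eq_normalClosure`, `AlexanderHNN.commutator_eq_ker`,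
  `AlexanderHNN.of_mem_commutator`: the kernel of `ψ : Γ → ℤ` (`of g ↦ 0`, `t ↦ 1`) is the normal
  closure of the vertex group; it is `Γ'` as soon as the vertex group lies in `Γ'`, which holds
  when `Γᵃᵇ ≅ ℤ` is generated by `[t]`.
* `AlexanderHNN.span_eq_top`: the classes `[of gⱼ]` of lifts of a `ℤ`-basis of `Gᵃᵇ` generate
  `Γ'/Γ''` over `R`.
* `AlexanderHNN.sum_row_smul_eq_zero`, `AlexanderHNN.mem_span_rows_of_sum_smul_eq_zero`: the module
  of `R`-linear relations among them is spanned by the rows `(P₋ i j − [t] • P₊ i j)ⱼ`, one for each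
  generator `aᵢ` of `A`, where `P₊`, `P₋` are the integer coordinate matrices of `āᵢ` and `φ(aᵢ)‾`
  in the basis of `Gᵃᵇ` (the relation says `[t]·[of aᵢ] = [t (of aᵢ) t⁻¹] = [of (φ aᵢ)]`).
* `AlexanderHNN.exists_presentation`, `AlexanderHNN.exists_presentation_laurent`: packaged as an
  `R`-linear surjection `Rⁿ → Γ'/Γ''` with kernel spanned by the rows of `P₋ − t P₊` (over
  `ℤ[t, t⁻¹]`, pulled back along `laurentEquivOfMulEquiv`), i.e. `Γ'/Γ'' ≅ Rⁿ / (P₋ − tP₊)`; for a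
  Seifert surface of genus `g` (`m = n = 2g`, `P₋ = V`, `P₊ = Vᵀ`) the matrix is `V − tVᵀ`.

## The proof (no normal forms)

Generation: `Γ' = ker ψ` is the normal closure of the vertex group (the quotient by that normal
closure is cyclic on the image of `t` and maps onto `ℤ`), the subgroup attached to the span of the
`[of gⱼ]` (`alexanderModule.comap`, `AlexanderModuleTrivializer.lean`) is normal and contains the
vertex group. Completeness of the relations: with `P = Rⁿ/(rows)` and `Γᵃᵇ` acting on `P` through
the units `[γ] ∈ R`, the universal property of the HNN extension (`HNNExtension.lift`) gives
`Θ : Γ → P ⋊ Γᵃᵇ`, `of g ↦ (coordinates of ḡ, 1)`, `t ↦ (0, [t])` — the rows are precisely what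
makes `Θ` compatible with `t a t⁻¹ = φ a`; on `Γ'` the second component of `Θ` is trivial, so `Θ`
restricts to a homomorphism `Γ' → P`, factors through `Γ'/Γ''`, turns conjugation by `γ` into the
action of `[γ]`, and sends `[γ]·[of gⱼ]` to the class of `[γ] eⱼ`: it inverts the presentation map,
whose kernel is therefore `(rows)`. This is the degree `≤ 1` part of the Mayer–Vietoris sequence of
an HNN extension (Bieri (1975); Brown, *Cohomology of Groups*, VII.9) with coefficients `ℤ[Γ/Γ']`,
made explicit.

## References

* R. Bieri, *Mayer–Vietoris sequences for HNN-groups and homological duality*, Math. Z. 143 (1975),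
  123–130. [Bieri1975]
* R. C. Lyndon, P. E. Schupp, *Combinatorial Group Theory* (1977/2001), Ch. IV §2 (HNN extensions).
  [LyndonSchupp2001]
* D. Rolfsen, *Knots and Links* (1976), §8.C (Seifert matrices present the Alexander module).
  [Rolfsen1976]
* G. Burde, H. Zieschang, *Knots*, 2nd ed. (2003), Ch. 9 (Alexander module from a Seifert surface).
  [BurdeZieschang2003]
* R. H. Crowell, R. H. Fox, *Introduction to Knot Theory* (1963), Ch. VIII §3 (the Alexander module
  `G'/G''`). [CrowellFox1963]

## Design notes

* Theorems only (D-0026): the auxiliary objects (`ψ`, the class map `Gᵃᵇ → Γ'/Γ''`, the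
  presentation map, `P ⋊ Γᵃᵇ`, `Θ`) are either existential statements or live inside proofs; the
  hypotheses-parametrised style (`(ψ) (hψof) (hψt)`) follows `KnotGroupMulEquivProofs.lean`.
* Mathlib: `HNNExtension` (`of`, `t`, `lift`, `hom_ext`, `induction_on`), `SemidirectProduct`,
  `Abelianization.lift`, `MulAutMultiplicative`, `DistribMulAction.toAddAut`,
  `MonoidAlgebra.addMonoidHom_ext`, `Fintype.linearCombination`.
-/

noncomputable section

open scoped LaurentPolynomial
open HNNExtension Multiplicative

namespace Literature.Topology.FourManifolds

namespace AlexanderHNN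

variable {G : Type*} [Group G] {A B : Subgroup G} {φ : A ≃* B}

/-! ## The epimorphism `ψ : Γ → ℤ` and its kernel -/

/-- An HNN extension is generated by the vertex group and the stable letter. [folklore] -/
theorem closure_range_of_union_t :
    Subgroup.closure (Set.range (of : G → HNNExtension G A B φ) ∪ {t}) = ⊤ := by
  rw [eq_top_iff]
  rintro x -
  induction x using HNNExtension.induction_on with
  | of g => exact Subgroup.subset_closure (Or.inl ⟨g, rfl⟩)
  | t => exact Subgroup.subset_closure (Or.inr rfl)
  | mul x y hx hy => exact mul_mem hx hy
  | inv x hx => exact inv_mem hx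

/-- The epimorphism `ψ : Γ → ℤ` killing the vertex group and sending the stable letter to `1`
exists (universal property of the HNN extension). [folklore] -/
theorem exists_hom_int : ∃ ψ : HNNExtension G A B φ →* Multiplicative ℤ,
    (∀ g, ψ (of g) = 1) ∧ ψ t = ofAdd 1 :=
  ⟨HNNExtension.lift (1 : G →* Multiplicative ℤ) (ofAdd 1) (by intro a; simp), fun g => by simp,
    by simp⟩

/-- Elements of the commutator subgroup have trivial class in the abelianisation. [folklore] -/
theorem abelianizationOf_eq_one {H : Type*} [Group H] {x : H} (hx : x ∈ commutator H) :
    Abelianization.of x = 1 := by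
  rw [← MonoidHom.mem_ker, Abelianization.ker_of]
  exact hx

section Psi

variable (ψ : HNNExtension G A B φ →* Multiplicative ℤ) (hψof : ∀ g, ψ (of g) = 1)

include hψof

/-- The normal closure of the vertex group lies in the kernel of `ψ`. [folklore] -/
theorem normalClosure_le_ker :
    Subgroup.normalClosure (Set.range (of : G → HNNExtension G A B φ)) ≤ ψ.ker :=
  Subgroup.normalClosure_le_normal (by
    rintro _ ⟨g, rfl⟩
    exact (MonoidHom.mem_ker).2 (hψof g))

variable (hψt : ψ t = ofAdd 1)
include hψt

/-- **The kernel of `ψ : Γ → ℤ` is the normal closure of the vertex group.** The quotient of `Γ` by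
that normal closure is cyclic, generated by the image of `t`, and maps onto `ℤ`. [folklore] -/
theorem ker_eq_normalClosure :
    ψ.ker = Subgroup.normalClosure (Set.range (of : G → HNNExtension G A B φ)) := by
  refine le_antisymm ?_ (normalClosure_le_ker ψ hψof)
  set N := Subgroup.normalClosure (Set.range (of : G → HNNExtension G A B φ)) with hN
  -- every element of `Γ ⧸ N` is a power of the image of `t`
  have hgen : ∀ x : HNNExtension G A B φ, ∃ k : ℤ,
      (QuotientGroup.mk t : HNNExtension G A B φ ⧸ N) ^ k = QuotientGroup.mk x := by
    intro x
    have hx : x ∈ Subgroup.closure (Set.range (of : G → HNNExtension G A B φ) ∪ {t}) := by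
      rw [closure_range_of_union_t]; trivial
    refine Subgroup.closure_induction (p := fun x _ => ∃ k : ℤ,
      (QuotientGroup.mk t : HNNExtension G A B φ ⧸ N) ^ k = QuotientGroup.mk x) ?_ ?_ ?_ ?_ hx
    · rintro y (⟨g, rfl⟩ | rfl)
      · refine ⟨0, ?_⟩
        rw [zpow_zero, eq_comm, QuotientGroup.eq_one_iff]
        exact Subgroup.subset_normalClosure ⟨g, rfl⟩
      · exact ⟨1, zpow_one _⟩
    · exact ⟨0, by rw [zpow_zero, QuotientGroup.mk_one]⟩
    · rintro x y _ _ ⟨k, hk⟩ ⟨l, hl⟩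
      exact ⟨k + l, by rw [zpow_add, hk, hl, QuotientGroup.mk_mul]⟩
    · rintro x _ ⟨k, hk⟩
      exact ⟨-k, by rw [zpow_neg, hk, QuotientGroup.mk_inv]⟩
  intro x hx
  obtain ⟨k, hk⟩ := hgen x
  -- push `x` through `ψ`, which factors through `Γ ⧸ N`
  have h1 : QuotientGroup.lift N ψ (normalClosure_le_ker ψ hψof) (QuotientGroup.mk x) = 1 := by
    rw [QuotientGroup.lift_mk]
    exact hx
  rw [← hk, map_zpow, QuotientGroup.lift_mk, hψt] at h1
  have hk0 : k = 0 := by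
    have h2 := congrArg toAdd h1
    rwa [toAdd_zpow, toAdd_ofAdd, smul_eq_mul, mul_one, toAdd_one] at h2
  rw [← QuotientGroup.eq_one_iff, ← hk, hk0, zpow_zero]

/-- **`Γ' = ker ψ`** as soon as the vertex group lies in the commutator subgroup. [folklore] -/
theorem commutator_eq_ker
    (hG : ∀ g : G, (of g : HNNExtension G A B φ) ∈ commutator (HNNExtension G A B φ)) :
    commutator (HNNExtension G A B φ) = ψ.ker := by
  refine le_antisymm (Abelianization.commutator_subset_ker ψ) ?_
  rw [ker_eq_normalClosure ψ hψof hψt]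
  exact Subgroup.normalClosure_le_normal (by rintro _ ⟨g, rfl⟩; exact hG g)

end Psi

/-- If `Γᵃᵇ ≅ ℤ` with the class of the stable letter a generator, the vertex group lies in `Γ'`.
[folklore] -/
theorem of_mem_commutator (e : Abelianization (HNNExtension G A B φ) ≃* Multiplicative ℤ)
    (he : e (Abelianization.of t) = ofAdd 1) (g : G) :
    (of g : HNNExtension G A B φ) ∈ commutator (HNNExtension G A B φ) := by
  obtain ⟨ψ, hψof, hψt⟩ := (exists_hom_int : ∃ ψ : HNNExtension G A B φ →* Multiplicative ℤ, _)
  -- `[of g] = [t] ^ k`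
  obtain ⟨k, hk⟩ : ∃ k : ℤ, Abelianization.of t ^ k = Abelianization.of (of g) := by
    refine ⟨toAdd (e (Abelianization.of (of g))), e.injective ?_⟩
    rw [map_zpow, he, ← ofAdd_zsmul, smul_eq_mul, mul_one, ofAdd_toAdd]
  -- apply `ψ` (through `Γᵃᵇ`): `1 = ψ (of g) = (ψ t) ^ k`
  have hψ' := congrArg (Abelianization.lift ψ) hk
  rw [map_zpow, Abelianization.lift_apply_of, Abelianization.lift_apply_of, hψt, hψof] at hψ'
  have hk0 : k = 0 := by
    have h2 := congrArg toAdd hψ'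
    rwa [toAdd_zpow, toAdd_ofAdd, smul_eq_mul, mul_one, toAdd_one] at h2
  rw [hk0, zpow_zero] at hk
  rw [← Abelianization.ker_of, MonoidHom.mem_ker]
  exact hk.symm

/-! ## The class map `Gᵃᵇ → Γ'/Γ''` and the presentation map -/

section ClassMap

variable (hG : ∀ g : G, (of g : HNNExtension G A B φ) ∈ commutator (HNNExtension G A B φ))

/-- The class `[of g] ∈ Γ'/Γ''` of an element of the vertex group, as a monoid hom
`G →* Multiplicative (Γ'/Γ'')` (so that it factors through `Gᵃᵇ`). [folklore] -/
theorem exists_classHom : ∃ c : G →* Multiplicative (alexanderModule (HNNExtension G A B φ)),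
    ∀ g, c g = ofAdd (alexanderModule.mk ⟨of g, hG g⟩) := by
  refine ⟨MonoidHom.mk' (fun g => ofAdd (alexanderModule.mk ⟨of g, hG g⟩)) fun g h => ?_, fun g => rfl⟩
  rw [← ofAdd_add, ← alexanderModule.mk_mul]
  congr 2
  exact Subtype.ext (map_mul of g h)

/-- The class of `of g` depends only on the image of `g` in `Gᵃᵇ`: it is `ĉ ḡ` for the additive map
`ĉ : Gᵃᵇ → Γ'/Γ''` induced by the class map. [folklore] -/
theorem exists_classHom_abelianization :
    ∃ c : Additive (Abelianization G) →+ alexanderModule (HNNExtension G A B φ),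
      ∀ g, c (Additive.ofMul (Abelianization.of g)) = alexanderModule.mk ⟨of g, hG g⟩ := by
  obtain ⟨c, hc⟩ := exists_classHom hG
  refine ⟨(Abelianization.lift c).toAdditive, fun g => ?_⟩
  change toAdd (Abelianization.lift c (Abelianization.of g)) = _
  rw [Abelianization.lift_apply_of, hc, toAdd_ofAdd]

end ClassMap

/-! ## The presentation of `Γ'/Γ''` attached to bases of `Gᵃᵇ` and generators of `A` -/

section Presentation

variable (hG : ∀ g : G, (of g : HNNExtension G A B φ) ∈ commutator (HNNExtension G A B φ))
  {n m : ℕ} (b : Module.Basis (Fin n) ℤ (Additive (Abelianization G)))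
  (g : Fin n → G) (hg : ∀ j, Additive.ofMul (Abelianization.of (g j)) = b j)

include hg

/-- The class of `of g'` is the `ℤ`-combination of the classes of the `of gⱼ` given by the
coordinates of `ḡ'` in the basis `b` of `Gᵃᵇ`. [folklore] -/
theorem mk_of_eq_sum (g' : G) :
    alexanderModule.mk ⟨of g', hG g'⟩ =
      ∑ j, (b.repr (Additive.ofMul (Abelianization.of g')) j) •
        alexanderModule.mk ⟨of (g j), hG (g j)⟩ := by
  obtain ⟨c, hc⟩ := exists_classHom_abelianization hG
  rw [← hc]
  conv_lhs => rw [← b.sum_repr (Additive.ofMul (Abelianization.of g'))]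
  rw [map_sum]
  refine Finset.sum_congr rfl fun j _ => ?_
  rw [map_zsmul, ← hg j, hc]

/-- **Generation.** The classes `[of gⱼ]` of lifts of a basis of `Gᵃᵇ` generate `Γ'/Γ''` over
`ℤ[Γᵃᵇ]`: `Γ'` is the normal closure of the vertex group, and the classes of its elements are
`ℤ`-combinations of the `[of gⱼ]`. [folklore] -/
theorem span_eq_top :
    Submodule.span (MonoidAlgebra ℤ (Abelianization (HNNExtension G A B φ)))
      (Set.range fun j => alexanderModule.mk ⟨of (g j), hG (g j)⟩) = ⊤ := by
  obtain ⟨ψ, hψof, hψt⟩ := (exists_hom_int : ∃ ψ : HNNExtension G A B φ →* Multiplicative ℤ, _)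
  apply alexanderModule.eq_top_of_commutator_le_comap
  intro x hx
  rw [commutator_eq_ker ψ hψof hψt hG, ker_eq_normalClosure ψ hψof hψt] at hx
  refine (Subgroup.normalClosure_le_normal ?_ : Subgroup.normalClosure
    (Set.range (of : G → HNNExtension G A B φ)) ≤ alexanderModule.comap _) hx
  rintro _ ⟨g', rfl⟩
  refine ⟨hG g', ?_⟩
  rw [mk_of_eq_sum hG b g hg g']
  exact Submodule.sum_mem _ fun j _ =>
    Submodule.smul_of_tower_mem _ _ (Submodule.subset_span ⟨j, rfl⟩)

omit hg in
/-- `single 1 r` acts as the integer `r`. [folklore] -/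
theorem single_one_smul (r : ℤ) (x : alexanderModule (HNNExtension G A B φ)) :
    MonoidAlgebra.single (1 : Abelianization (HNNExtension G A B φ)) r • x = r • x := by
  rw [show MonoidAlgebra.single (1 : Abelianization (HNNExtension G A B φ)) r =
      r • (1 : MonoidAlgebra ℤ (Abelianization (HNNExtension G A B φ))) by
    rw [MonoidAlgebra.one_def, MonoidAlgebra.smul_single', mul_one], smul_assoc, one_smul]

omit hg in
/-- `single γ r` acts as `r` times the action of `γ`. [folklore] -/
theorem single_smul (γ : Abelianization (HNNExtension G A B φ)) (r : ℤ)
    (x : alexanderModule (HNNExtension G A B φ)) :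
    MonoidAlgebra.single γ r • x =
      r • (MonoidAlgebra.of ℤ (Abelianization (HNNExtension G A B φ)) γ • x) := by
  rw [← smul_assoc, MonoidAlgebra.of_apply, MonoidAlgebra.smul_single', mul_one]

variable (a : Fin m → A) (Pp Pm : Matrix (Fin m) (Fin n) ℤ)
  (hPp : ∀ i j, b.repr (Additive.ofMul (Abelianization.of (a i : G))) j = Pp i j)
  (hPm : ∀ i j, b.repr (Additive.ofMul (Abelianization.of (φ (a i) : G))) j = Pm i j)

include hPp hPm

/-- **Relations.** For each generator `aᵢ` of the edge group, the row
`(single 1 (P₋ i j) − single [t] (P₊ i j))ⱼ` — the coordinates of `φ(aᵢ)‾ − t · āᵢ` — is a relation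
among the classes `[of gⱼ]`: it expresses `[of (φ aᵢ)] = [t (of aᵢ) t⁻¹] = [t] · [of aᵢ]`.
[folklore] -/
theorem sum_row_smul_eq_zero (i : Fin m) :
    ∑ j, (MonoidAlgebra.single (1 : Abelianization (HNNExtension G A B φ)) (Pm i j : ℤ) -
        MonoidAlgebra.single (Abelianization.of t) (Pp i j : ℤ)) •
      alexanderModule.mk ⟨of (g j), hG (g j)⟩ = 0 := by
  have h1 : ∀ j, MonoidAlgebra.single (1 : Abelianization (HNNExtension G A B φ)) (Pm i j : ℤ) •
      alexanderModule.mk ⟨of (g j), hG (g j)⟩ = (Pm i j : ℤ) • alexanderModule.mk ⟨of (g j), hG (g j)⟩ :=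
    fun j => single_one_smul _ _
  have h2 : ∀ j, MonoidAlgebra.single (Abelianization.of t) (Pp i j : ℤ) •
      alexanderModule.mk ⟨of (g j), hG (g j)⟩ =
        MonoidAlgebra.of ℤ (Abelianization (HNNExtension G A B φ)) (Abelianization.of t) •
          ((Pp i j : ℤ) • alexanderModule.mk ⟨of (g j), hG (g j)⟩) :=
    fun j => by rw [single_smul, smul_comm]
  simp only [sub_smul, Finset.sum_sub_distrib, h1, h2, ← Finset.smul_sum]
  have hm : ∑ j, (Pm i j : ℤ) • alexanderModule.mk ⟨of (g j), hG (g j)⟩ =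
      alexanderModule.mk ⟨of (φ (a i) : G), hG _⟩ := by
    rw [mk_of_eq_sum hG b g hg (φ (a i) : G)]
    exact Finset.sum_congr rfl fun j _ => by rw [hPm]
  have hp : ∑ j, (Pp i j : ℤ) • alexanderModule.mk ⟨of (g j), hG (g j)⟩ =
      alexanderModule.mk ⟨of (a i : G), hG _⟩ := by
    rw [mk_of_eq_sum hG b g hg (a i : G)]
    exact Finset.sum_congr rfl fun j _ => by rw [hPp]
  rw [hm, hp, alexanderModule.of_smul_mk, sub_eq_zero]
  congr 1
  apply Subtype.ext
  rw [MulAut.conjNormal_apply]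
  change (of (φ (a i) : G) : HNNExtension G A B φ) = t * of (a i : G) * t⁻¹
  rw [t_mul_of, mul_inv_cancel_right]

variable (ha : Subgroup.closure (Set.range a) = ⊤)
include ha

/-- **Completeness of the relations** (the heart of the matter). Every relation among the classes
`[of gⱼ]` is a `ℤ[Γᵃᵇ]`-combination of the rows of `sum_row_smul_eq_zero`. Proof without normal
forms: let `P = ℤ[Γᵃᵇ]ⁿ / (rows)`; the universal property of the HNN extension gives a homomorphism
`Θ : Γ → P ⋊ Γᵃᵇ` (`Γᵃᵇ` acting on `P` through the group ring), `of g ↦ (coordinates of ḡ, 1)`,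
`t ↦ (0, [t])` — the rows are exactly what makes `t · of a · t⁻¹ ↦ of (φ a)` compatible; on `Γ'` it is
`P`-valued, factors through `Γ'/Γ''`, is `ℤ[Γᵃᵇ]`-linear, and inverts the presentation map on the
generators. [folklore] -/
theorem mem_span_rows_of_sum_smul_eq_zero
    (v : Fin n → MonoidAlgebra ℤ (Abelianization (HNNExtension G A B φ)))
    (hv : ∑ j, v j • alexanderModule.mk ⟨of (g j), hG (g j)⟩ = 0) :
    v ∈ Submodule.span (MonoidAlgebra ℤ (Abelianization (HNNExtension G A B φ)))
      (Set.range fun i j =>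
        MonoidAlgebra.single (1 : Abelianization (HNNExtension G A B φ)) (Pm i j : ℤ) -
          MonoidAlgebra.single (Abelianization.of t) (Pp i j : ℤ)) := by
  classical
  set τ : Abelianization (HNNExtension G A B φ) := Abelianization.of t with hτ
  set rows : Fin m → Fin n → MonoidAlgebra ℤ (Abelianization (HNNExtension G A B φ)) :=
    fun i j => MonoidAlgebra.single (1 : Abelianization (HNNExtension G A B φ)) (Pm i j : ℤ) -
      MonoidAlgebra.single τ (Pp i j : ℤ) with hrows
  set W := Submodule.span (MonoidAlgebra ℤ (Abelianization (HNNExtension G A B φ)))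
    (Set.range rows) with hW
  -- (a) integer coordinates in the basis `b`, pushed into the group ring
  obtain ⟨coords, hco⟩ : ∃ coords : Additive (Abelianization G) →+
      (Fin n → MonoidAlgebra ℤ (Abelianization (HNNExtension G A B φ))),
      ∀ y j, coords y j = MonoidAlgebra.single 1 (b.repr y j) :=
    ⟨{ toFun := fun y j => MonoidAlgebra.single 1 (b.repr y j)
       map_zero' := by funext j; simp
       map_add' := fun y y' => by funext j; simp [MonoidAlgebra.single_add] }, fun _ _ => rfl⟩
  -- (b) the action of `Γᵃᵇ` on `P = Rⁿ / W` through the units `[γ]` of the group ring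
  set act : Abelianization (HNNExtension G A B φ) →*
      MulAut (Multiplicative ((Fin n → MonoidAlgebra ℤ (Abelianization (HNNExtension G A B φ))) ⧸ W)) :=
    (MulAutMultiplicative ((Fin n → MonoidAlgebra ℤ (Abelianization (HNNExtension G A B φ))) ⧸ W)).symm.toMonoidHom.comp
      ((DistribMulAction.toAddAut (MonoidAlgebra ℤ (Abelianization (HNNExtension G A B φ)))ˣ
        ((Fin n → MonoidAlgebra ℤ (Abelianization (HNNExtension G A B φ))) ⧸ W)).comp
        (MonoidAlgebra.of ℤ (Abelianization (HNNExtension G A B φ))).toHomUnits) with hact_def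
  have hact : ∀ (γ : Abelianization (HNNExtension G A B φ))
      (p : Multiplicative ((Fin n → MonoidAlgebra ℤ (Abelianization (HNNExtension G A B φ))) ⧸ W)),
      act γ p = ofAdd (MonoidAlgebra.of ℤ (Abelianization (HNNExtension G A B φ)) γ • toAdd p) :=
    fun γ p => rfl
  have hcancel : ∀ (γ : Abelianization (HNNExtension G A B φ))
      (p : Multiplicative ((Fin n → MonoidAlgebra ℤ (Abelianization (HNNExtension G A B φ))) ⧸ W)),
      act γ (act γ⁻¹ p) = p := fun γ p => by
    rw [← MulAut.mul_apply, ← map_mul, mul_inv_cancel, map_one, MulAut.one_apply]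
  -- (c) the vertex group mapped to `P`
  obtain ⟨cG, hcG⟩ : ∃ cG : G →*
      Multiplicative ((Fin n → MonoidAlgebra ℤ (Abelianization (HNNExtension G A B φ))) ⧸ W),
      ∀ g', cG g' = ofAdd (W.mkQ (coords (Additive.ofMul (Abelianization.of g')))) :=
    ⟨{ toFun := fun g' => ofAdd (W.mkQ (coords (Additive.ofMul (Abelianization.of g'))))
       map_one' := by simp
       map_mul' := fun g₁ g₂ => by simp [ofMul_mul, ofAdd_add] }, fun _ => rfl⟩
  -- (d) the relations make `[t] · (coordinates of ā) = coordinates of φ(a)‾` in `P`, for all `a ∈ A`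
  have hD : ∀ a' : A, W.mkQ (coords (Additive.ofMul (Abelianization.of (φ a' : G)))) =
      MonoidAlgebra.of ℤ (Abelianization (HNNExtension G A B φ)) τ •
        W.mkQ (coords (Additive.ofMul (Abelianization.of (a' : G)))) := by
    intro a'
    have hmem : a' ∈ Subgroup.closure (Set.range a) := by rw [ha]; trivial
    refine Subgroup.closure_induction (p := fun a' _ =>
      W.mkQ (coords (Additive.ofMul (Abelianization.of (φ a' : G)))) =
        MonoidAlgebra.of ℤ (Abelianization (HNNExtension G A B φ)) τ •
          W.mkQ (coords (Additive.ofMul (Abelianization.of (a' : G))))) ?_ ?_ ?_ ?_ hmem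
    · rintro _ ⟨i, rfl⟩
      rw [← map_smul, ← sub_eq_zero, ← map_sub, Submodule.mkQ_apply, Submodule.Quotient.mk_eq_zero]
      have hrow : coords (Additive.ofMul (Abelianization.of (φ (a i) : G))) -
          MonoidAlgebra.of ℤ (Abelianization (HNNExtension G A B φ)) τ •
            coords (Additive.ofMul (Abelianization.of (a i : G))) = rows i := by
        funext j
        simp only [Pi.sub_apply, Pi.smul_apply, hco, hPm, hPp, smul_eq_mul, MonoidAlgebra.of_apply,
          MonoidAlgebra.single_mul_single, one_mul, mul_one, hrows]
      rw [hrow]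
      exact Submodule.subset_span ⟨i, rfl⟩
    · simp
    · intro x y _ _ hx hy
      simp only [map_mul, Subgroup.coe_mul, ofMul_mul, map_add, smul_add, hx, hy]
    · intro x _ hx
      simp only [map_inv, Subgroup.coe_inv, ofMul_inv, map_neg, smul_neg, hx]
  -- (e) the compatibility `x₀ · f₀ a = f₀ (φ a) · x₀` in `P ⋊ Γᵃᵇ`
  have hcompat : ∀ a' : A,
      (SemidirectProduct.inr τ : Multiplicative ((Fin n → MonoidAlgebra ℤ
        (Abelianization (HNNExtension G A B φ))) ⧸ W) ⋊[act] Abelianization (HNNExtension G A B φ)) *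
          (SemidirectProduct.inl.comp cG) (a' : G) =
        (SemidirectProduct.inl.comp cG) (φ a' : G) * SemidirectProduct.inr τ := by
    intro a'
    refine SemidirectProduct.ext ?_ ?_
    · change 1 * act τ (cG (a' : G)) = cG (φ a' : G) * act 1 1
      rw [map_one]
      simp only [mul_one, one_mul]
      rw [hcG, hcG, hact, toAdd_ofAdd, ← hD a']
    · change τ * 1 = 1 * τ
      rw [mul_one, one_mul]
  -- (f) the homomorphism `Θ : Γ → P ⋊ Γᵃᵇ` and its second component
  set Θ := HNNExtension.lift (SemidirectProduct.inl.comp cG) (SemidirectProduct.inr τ) hcompat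
    with hΘ
  have hΘright : ∀ γ, (Θ γ).right = Abelianization.of γ := by
    have hh : SemidirectProduct.rightHom.comp Θ = Abelianization.of := by
      apply HNNExtension.hom_ext
      · ext g'
        rw [MonoidHom.comp_apply, MonoidHom.comp_apply, MonoidHom.comp_apply, hΘ,
          HNNExtension.lift_of, MonoidHom.comp_apply, SemidirectProduct.rightHom_inl]
        exact (abelianizationOf_eq_one (hG g')).symm
      · rw [MonoidHom.comp_apply, hΘ, HNNExtension.lift_t, SemidirectProduct.rightHom_inr]
    intro γ
    have := DFunLike.congr_fun hh γ
    rwa [MonoidHom.comp_apply, SemidirectProduct.rightHom_eq_right] at this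
  have hright1 : ∀ nn : commutator (HNNExtension G A B φ),
      (Θ (nn : HNNExtension G A B φ)).right = 1 := fun nn => by
    rw [hΘright]
    exact abelianizationOf_eq_one nn.2
  -- (g) restriction to `Γ'` is `P`-valued and multiplicative; factor through `Γ'/Γ''`
  obtain ⟨θ₀, hθ₀⟩ : ∃ θ₀ : commutator (HNNExtension G A B φ) →*
      Multiplicative ((Fin n → MonoidAlgebra ℤ (Abelianization (HNNExtension G A B φ))) ⧸ W),
      ∀ nn, θ₀ nn = (Θ (nn : HNNExtension G A B φ)).left :=
    ⟨{ toFun := fun nn => (Θ (nn : HNNExtension G A B φ)).left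
       map_one' := by rw [OneMemClass.coe_one, map_one, SemidirectProduct.one_left]
       map_mul' := fun n₁ n₂ => by
         rw [Subgroup.coe_mul, map_mul, SemidirectProduct.mul_left, hright1, map_one,
           MulAut.one_apply] }, fun _ => rfl⟩
  obtain ⟨ΘA, hΘA⟩ : ∃ ΘA : alexanderModule (HNNExtension G A B φ) →+
      ((Fin n → MonoidAlgebra ℤ (Abelianization (HNNExtension G A B φ))) ⧸ W),
      ∀ nn : commutator (HNNExtension G A B φ),
        ΘA (alexanderModule.mk nn) = toAdd (Θ (nn : HNNExtension G A B φ)).left := by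
    refine ⟨(MonoidHom.toAdditiveLeft (Abelianization.lift θ₀)).comp
      (alexanderRep (HNNExtension G A B φ)).asModuleEquiv.toAddMonoidHom, fun nn => ?_⟩
    rw [AddMonoidHom.comp_apply, alexanderModule.mk]
    change toAdd (Abelianization.lift θ₀ (Additive.toMul ((alexanderRep (HNNExtension G A B φ)).asModuleEquiv
      ((alexanderRep (HNNExtension G A B φ)).asModuleEquiv.symm
        (Additive.ofMul (Abelianization.of nn)))))) = _
    rw [LinearEquiv.apply_symm_apply, toMul_ofMul, Abelianization.lift_apply_of, hθ₀]
  -- (h) conjugation in `Γ` becomes the action of `Γᵃᵇ` on `P`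
  have hconj : ∀ (γ : HNNExtension G A B φ) (nn : commutator (HNNExtension G A B φ)),
      (Θ (γ * nn * γ⁻¹)).left = act (Abelianization.of γ) (Θ (nn : HNNExtension G A B φ)).left := by
    intro γ nn
    rw [map_mul, map_mul, map_inv, SemidirectProduct.mul_left, SemidirectProduct.mul_left,
      SemidirectProduct.inv_left, SemidirectProduct.mul_right, hright1, mul_one, hcancel, hΘright,
      mul_inv_cancel_comm]
  -- (i) the key computation on the generators `[γ] • [of gⱼ]`
  have hKC : ∀ (γ : HNNExtension G A B φ) (j : Fin n),
      ΘA (MonoidAlgebra.of ℤ (Abelianization (HNNExtension G A B φ)) (Abelianization.of γ) •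
        alexanderModule.mk ⟨of (g j), hG (g j)⟩) =
      W.mkQ (Pi.single j (MonoidAlgebra.of ℤ (Abelianization (HNNExtension G A B φ))
        (Abelianization.of γ))) := by
    intro γ j
    rw [alexanderModule.of_smul_mk, hΘA]
    have hc : ((MulAut.conjNormal γ (⟨of (g j), hG (g j)⟩ : commutator (HNNExtension G A B φ)) :
        commutator (HNNExtension G A B φ)) : HNNExtension G A B φ) =
        γ * ((⟨of (g j), hG (g j)⟩ : commutator (HNNExtension G A B φ)) : HNNExtension G A B φ) * γ⁻¹ :=
      MulAut.conjNormal_apply _ _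
    rw [hc, hconj, hact, toAdd_ofAdd]
    have hval : ((⟨of (g j), hG (g j)⟩ : commutator (HNNExtension G A B φ)) : HNNExtension G A B φ) =
      of (g j) := rfl
    rw [hval, hΘ, HNNExtension.lift_of, MonoidHom.comp_apply, SemidirectProduct.left_inl, hcG,
      toAdd_ofAdd, ← map_smul]
    congr 1
    funext j'
    rw [Pi.smul_apply, hco, hg, b.repr_self, smul_eq_mul, Pi.single_apply, Finsupp.single_apply]
    by_cases h : j' = j
    · subst h
      rw [if_pos rfl, if_pos rfl, ← MonoidAlgebra.one_def, mul_one]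
    · rw [if_neg h, if_neg (Ne.symm h), MonoidAlgebra.single_zero, mul_zero]
  -- (j) `ΘA ∘ (presentation map) = (quotient map)` as additive maps `Rⁿ → P`
  have hext : ΘA.comp (Fintype.linearCombination (MonoidAlgebra ℤ (Abelianization (HNNExtension G A B φ)))
      (fun j => alexanderModule.mk ⟨of (g j), hG (g j)⟩)).toAddMonoidHom = W.mkQ.toAddMonoidHom := by
    refine AddMonoidHom.functions_ext _ _ _ fun j r => ?_
    suffices h : (ΘA.comp (Fintype.linearCombination (MonoidAlgebra ℤ (Abelianization (HNNExtension G A B φ)))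
        (fun j => alexanderModule.mk ⟨of (g j), hG (g j)⟩)).toAddMonoidHom).comp
          (AddMonoidHom.single _ j) = W.mkQ.toAddMonoidHom.comp (AddMonoidHom.single _ j) from
      DFunLike.congr_fun h r
    refine MonoidAlgebra.addMonoidHom_ext fun γ z => ?_
    obtain ⟨γ₀, hγ₀⟩ := QuotientGroup.mk_surjective γ
    have hγ : Abelianization.of γ₀ = γ := hγ₀
    subst hγ
    rw [AddMonoidHom.comp_apply, AddMonoidHom.comp_apply, AddMonoidHom.single_apply,
      AddMonoidHom.comp_apply, LinearMap.toAddMonoidHom_coe, LinearMap.toAddMonoidHom_coe,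
      Fintype.linearCombination_apply_single, single_smul, map_zsmul, hKC, ← map_zsmul]
    congr 1
    rw [← Pi.single_smul, MonoidAlgebra.of_apply, MonoidAlgebra.smul_single, smul_eq_mul, mul_one]
    rfl
  -- (k) conclusion
  have hv' : W.mkQ v = 0 := by
    have h := DFunLike.congr_fun hext v
    rw [AddMonoidHom.comp_apply, LinearMap.toAddMonoidHom_coe, LinearMap.toAddMonoidHom_coe,
      Fintype.linearCombination_apply, hv, map_zero] at h
    exact h.symm
  rwa [Submodule.mkQ_apply, Submodule.Quotient.mk_eq_zero] at hv'

/-- **The presentation of the Alexander module of an HNN extension.** Let `Γ = ⟨G, t | t a t⁻¹ = φ a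
(a ∈ A)⟩` be an HNN extension whose vertex group lies in `Γ'` (e.g. `Γᵃᵇ ≅ ℤ` generated by `[t]`,
`of_mem_commutator`), let `b` be a `ℤ`-basis of `Gᵃᵇ` indexed by `Fin n` with lifts `gⱼ ∈ G`, let
`a₁, …, aₘ` generate the edge group `A`, and let `P₊`, `P₋` be the integer matrices of coordinates of
`āᵢ` and `φ(aᵢ)‾` in the basis `b`. Then `Γ'/Γ''` is generated over `ℤ[Γᵃᵇ]` by the classes
`[of gⱼ]`, and the module of relations is spanned by the `m` rows `(P₋ i j − [t] P₊ i j)ⱼ`: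
`Γ'/Γ'' ≅ ℤ[Γᵃᵇ]ⁿ / (P₋ − [t] P₊)`. This is the degree-one part of the Mayer–Vietoris sequence of
the HNN extension with coefficients `ℤ[Γ/Γ']` (Bieri (1975); Brown, *Cohomology of Groups*, VII.9),
in the elementary form used for knot groups split along a Seifert surface (Rolfsen (1976), §8.C;
Burde–Zieschang, *Knots*, Ch. 9): there `G = π₁(S³ ∖ F)`, `A = π₁(F)`, and `P₋`, `P₊ᵀ` are a Seifert
matrix and its transpose. [folklore] -/
theorem exists_presentation :
    ∃ π : (Fin n → MonoidAlgebra ℤ (Abelianization (HNNExtension G A B φ))) →ₗ[MonoidAlgebra ℤ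
      (Abelianization (HNNExtension G A B φ))] alexanderModule (HNNExtension G A B φ),
      (∀ v, π v = ∑ j, v j • alexanderModule.mk ⟨of (g j), hG (g j)⟩) ∧
      Function.Surjective π ∧
      LinearMap.ker π = Submodule.span (MonoidAlgebra ℤ (Abelianization (HNNExtension G A B φ)))
        (Set.range fun i j =>
          MonoidAlgebra.single (1 : Abelianization (HNNExtension G A B φ)) (Pm i j : ℤ) -
            MonoidAlgebra.single (Abelianization.of t) (Pp i j : ℤ)) := by
  refine ⟨Fintype.linearCombination (MonoidAlgebra ℤ (Abelianization (HNNExtension G A B φ)))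
    (fun j => alexanderModule.mk ⟨of (g j), hG (g j)⟩), fun v => rfl, ?_, ?_⟩
  · rw [← LinearMap.range_eq_top, Fintype.range_linearCombination]
    exact span_eq_top hG b g hg
  · apply le_antisymm
    · intro v hv
      rw [LinearMap.mem_ker, Fintype.linearCombination_apply] at hv
      exact mem_span_rows_of_sum_smul_eq_zero hG b g hg a Pp Pm hPp hPm ha v hv
    · rw [Submodule.span_le]
      rintro _ ⟨i, rfl⟩
      rw [SetLike.mem_coe, LinearMap.mem_ker, Fintype.linearCombination_apply]
      exact sum_row_smul_eq_zero hG b g hg a Pp Pm hPp hPm i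

end Presentation

/-- **The presentation, pushed to `ℤ[t, t⁻¹]`.** With `e : Γᵃᵇ ≃* ℤ` sending `[t]` to `1` (so the
vertex group lies in `Γ'`), the Alexander module `Γ'/Γ''` of the HNN extension has a square-free
presentation: a `ℤ[Γᵃᵇ]`-linear surjection `ℤ[Γᵃᵇ]ⁿ → Γ'/Γ''` whose kernel is spanned by the rows of
the `m × n` matrix `P₋ − t P₊` over `ℤ[t, t⁻¹]`, pulled back along `laurentEquivOfMulEquiv Γ e`. For a
knot group split along a Seifert surface of genus `g` (`m = n = 2g`, `P₋ = V`, `P₊ = Vᵀ`) this is the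
classical presentation matrix `V − tVᵀ` (Rolfsen (1976), §8.C). [folklore] -/
theorem exists_presentation_laurent (e : Abelianization (HNNExtension G A B φ) ≃* Multiplicative ℤ)
    (he : e (Abelianization.of t) = ofAdd 1)
    {n m : ℕ} (b : Module.Basis (Fin n) ℤ (Additive (Abelianization G)))
    (g : Fin n → G) (hg : ∀ j, Additive.ofMul (Abelianization.of (g j)) = b j)
    (a : Fin m → A) (ha : Subgroup.closure (Set.range a) = ⊤) (Pp Pm : Matrix (Fin m) (Fin n) ℤ)
    (hPp : ∀ i j, b.repr (Additive.ofMul (Abelianization.of (a i : G))) j = Pp i j)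
    (hPm : ∀ i j, b.repr (Additive.ofMul (Abelianization.of (φ (a i) : G))) j = Pm i j) :
    ∃ π : (Fin n → MonoidAlgebra ℤ (Abelianization (HNNExtension G A B φ))) →ₗ[MonoidAlgebra ℤ
      (Abelianization (HNNExtension G A B φ))] alexanderModule (HNNExtension G A B φ),
      Function.Surjective π ∧
      LinearMap.ker π = Submodule.span (MonoidAlgebra ℤ (Abelianization (HNNExtension G A B φ)))
        (Set.range ((Pm.map (LaurentPolynomial.C : ℤ →+* ℤ[T;T⁻¹]) -
          (LaurentPolynomial.T 1 : ℤ[T;T⁻¹]) • Pp.map (LaurentPolynomial.C : ℤ →+* ℤ[T;T⁻¹])).map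
            (laurentEquivOfMulEquiv (HNNExtension G A B φ) e).symm)) := by
  have hG : ∀ g' : G, (of g' : HNNExtension G A B φ) ∈ commutator (HNNExtension G A B φ) :=
    of_mem_commutator e he
  obtain ⟨π, -, hπ, hker⟩ := exists_presentation hG b g hg a Pp Pm hPp hPm ha
  refine ⟨π, hπ, ?_⟩
  rw [hker]
  congr 2
  funext i j
  rw [Matrix.map_apply, eq_comm, RingEquiv.symm_apply_eq, map_sub, laurentEquivOfMulEquiv_single,
    laurentEquivOfMulEquiv_single, map_one, he, toAdd_one, toAdd_ofAdd, LaurentPolynomial.T_zero,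
    mul_one, Matrix.sub_apply, Matrix.smul_apply, Matrix.map_apply, Matrix.map_apply, smul_eq_mul,
    mul_comm]

end AlexanderHNN

end Literature.Topology.FourManifolds
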